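import Summits.BirchSwinnertonDyer.BirchSwinnertonDyer.Theorems.InertBadSignedBranchesCccOneLawOnTypeIstarZeroOfLowerHalf
import HarnessLib

/-!
# Route `InertBadSignedBranches` (rung K8), crux `CccOneLawOnTypeIstarZero`: the rung leaf
# `X12.CMInertBad` through the LOWER HALF ON THE TYPE instead of the crux's `p`-adic currency —
# no signed-`p`-adic-`L` reading (item 19226) is needed for the `I₀*` conjunct
# (helper toward stmt-BirchSwinnertonDyer-19223; cell bsd-cm, seat bsd-cm-k8i-c2; nothing asserted)

The route's deciding bridge (`CMRungInputs.cmInertBad_of_inputs`) feeds the attacked crux C-cc-1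
(`CccOneLawOnTypeIstarZero`, `p`-adic currency: the valuation of `coeff₁ L_p⁻(V, η, X)`) together
with the PRINT READINGS item `PrintReadingsInert` (19226, conjecture-grade by design) and
`PublishedFactsInert` (19227) into `BSD_p` on the signed type `(p, I₀*)`. The companion files
(`…StubHalves`, `…StubsOnType`) show that, modulo those two items, the crux's registered stubs are
the two halves of `BSD_p` on the type, the open one being the LOWER half
`X12.O10.LowerHalfOnType p I₀*`. THIS FILE records the consequence for the LEAF:

* `cmInertBad_of_lowerHalfOnType_of_upperHalf_five_seven` — **the rung leaf `X12.CMInertBad`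
  FOLLOWS from: the lower half on the type at every `p ≥ 5` + the upper half on the type at
  `p ∈ {5, 7}` (the Manin datum of the every-curve Kolyvagin half; published at `p ≥ 11`, x1b
  `X12.missingInputAt_of_classX12_of_cmInert_of_lower`) + the two residual conjuncts
  `InertBadOffType` / `InertBadAtThree` + the eleven published facts** — WITHOUT C-cc-1, WITHOUT
  `PrintReadingsInert`, without any `p`-adic `L`-function;
* `lowerHalfOnType_of_cmInertBad` — conversely the leaf gives the lower half on the type at every
  `p ≥ 5` (unfolding; no fact).
READING for the planner / tribunal: the `I₀*` conjunct of the leaf is, modulo print, EXACTLY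
"`∀ p ≥ 5, LowerHalfOnType p I₀*`" (x1b's class target of record, `@[conjecture]`, label OBJECT) plus
the Manin datum at `p ∈ {5, 7}`; the crux C-cc-1 is one ATTACK on it (through the readings of
19226), equivalent to it only modulo 19226/19227 (`CccOneLowerHalf.cccOneLawAt_iff_lowerHalfOnType…`,
`CccOneStubHalves.stubLowerAt_iff_lowerHalfOnType`).

HONEST LABEL: CONDITIONAL on displayed hypotheses (typed conjecture items = the route's residual
cruxes and x1b's `LowerHalfOnType`, published named facts, the `p ∈ {5,7}` upper-half datum); no
`def`, no named fact minted, nothing booked; the leaf, the crux 19223 and O10 stay OPEN.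
[cite: MatarNekovar2019, Thm. 0.3 and §0.11] [cite: EdixhovenManin1991, Thm. 3]
[cite: BurungaleFlach2024, Thm. 1.1 and Cor. 2] [cite: Miller2011LMS, §1 and Def. 1.1]
-/

set_option autoImplicit false
set_option linter.dupNamespace false

noncomputable section

open scoped Classical NumberField

open WeierstrassCurve NumberField IsDedekindDomain
open Literature.NumberTheory.EllipticCurves
open Literature.NumberTheory.EllipticCurves.ModularForms
open Literature.NumberTheory.EllipticCurves.Rank1Residual
open Literature.NumberTheory.EllipticCurves.Rank1Residual.Typed
open Summit.BirchSwinnertonDyer.Rank1Residual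
open Summit.BirchSwinnertonDyer.Rank1Residual.X12.O10
open Summit.BirchSwinnertonDyer.BirchSwinnertonDyer.Theses.InertBadSignedBranches

namespace Summit.BirchSwinnertonDyer.BirchSwinnertonDyer.Theorems.CccOneStubHalves

/-- **The rung leaf K8 `X12.CMInertBad` FROM the lower half on the signed type `(p, I₀*)` at every
`p ≥ 5`, the upper half on the type at `p ∈ {5, 7}`, the two residual conjuncts of the route, and the
eleven published facts of x1b's every-curve Kolyvagin half** — the route's bridge
`CMRungInputs.cmInertBad_of_inputs` with its `(C-cc-1, readings) ↦ BSD_p` step replaced by x1b's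
`X12.missingInputAt_of_classX12_of_cmInert_of_lower` (`p ≥ 11`) / the two halves (`p ∈ {5, 7}`).
No `p`-adic `L`-function, no reading. CONDITIONAL; nothing booked.
[cite: MatarNekovar2019, Thm. 0.3 and §0.11] [cite: EdixhovenManin1991, Thm. 3]
[cite: BurungaleFlach2024, Thm. 1.1 and Cor. 2] [cite: Miller2011LMS, §1 and Def. 1.1] -/
theorem cmInertBad_of_lowerHalfOnType_of_upperHalf_five_seven
    (hGZ : ∀ (N : ℕ) [NeZero N] (W : WeierstrassCurve ℚ) (K : Type) [Field K] [NumberField K],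
      gross_zagier N W K)
    (hKo : ∀ (N : ℕ) [NeZero N] (W : WeierstrassCurve ℚ) (K : Type) [Field K] [NumberField K],
      kolyvagin N W K)
    (hMN : ∀ (N : ℕ) [NeZero N] (W : WeierstrassCurve ℚ) (K : Type) [Field K] [NumberField K],
      MatarNekovar2019.thm03_padicValNat_card_sha_le_of_irreducible N W K)
    (hGZK : rank_eq_analyticRank_of_analyticRank_le_one) (hmod : hasEntireLFunction_rat)
    (hnf : exists_isNewformOf) (hFH : friedbergHoffstein_exists_heegnerField_split_twist_ne_zero)
    (hCM8 : bsdTriple_of_hasCM_of_L_one_ne_zero)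
    (hEdx : edixhoven_not_dvd_maninConstant_of_not_potentiallyGoodOrdinary)
    (hDeu : deuring_not_hasUnitRootAt_of_hasCM_of_not_cmSplit) (hCassels : bsdRHS_eq_of_isIsogenous)
    (hlow : ∀ (p : ℕ) [Fact p.Prime], 5 ≤ p → LowerHalfOnType p (.Istar 0))
    (hup57 : ∀ (p : ℕ) [Fact p.Prime], p = 5 ∨ p = 7 →
      ∀ (W : WeierstrassCurve ℚ) [W.IsElliptic] [W.IsGloballyMinimal],
      HasSignedLocalType W p (.Istar 0) → W.analyticRank = 1 → MissingUpperBoundAt W p)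
    (h₂ : InertBadOffType) (h₃ : InertBadAtThree) :
    Summit.BirchSwinnertonDyer.Rank1Residual.X12.CMInertBad := by
  intro W _ _ p _ hCM hr hp2 hin hbad
  have hp : p.Prime := Fact.out
  by_cases h3 : p = 3
  · subst h3
    exact h₃ W hCM hr hin hbad
  · have hp5 : 5 ≤ p := by
      by_contra hlt
      have hlt' : p < 5 := Nat.lt_of_not_le hlt
      interval_cases p
      · exact Nat.not_prime_zero hp
      · exact Nat.not_prime_one hp
      · exact hp2 rfl
      · exact h3 rfl
      · exact absurd hp (by decide)
    by_cases hT : HasSignedLocalType W p (.Istar 0)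
    · have hlo : MissingLowerBoundAt W p := hlow p hp5 W hT hr
      by_cases hp7 : 7 < p
      · exact X12.missingInputAt_of_classX12_of_cmInert_of_lower hGZ hKo hMN hGZK hmod hnf hFH hCM8
          hEdx hDeu hCassels W p (classX12_of_hasSignedLocalType W p hT hr) hp7 hT.2.1.1 hT.2.1.2 hlo
      · have h57 : p = 5 ∨ p = 7 := by
          have hle : p ≤ 7 := Nat.le_of_not_lt hp7
          have h6 : p ≠ 6 := by
            rintro rfl
            exact absurd hp (by norm_num)
          omega
        exact fun _ ↦ missingPPartAt_of_lower_of_upper W p hlo (hup57 p h57 W hT hr)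
    · exact h₂ W p hCM hr hin hbad hp5 hT

/-- **Conversely, the leaf gives the lower half on the type at every `p ≥ 5`** (`p ≠ 2`, `p` inert
hence not split: `X12.MissingInputAt` is the whole `MissingPPartAt`, whose lower half is read off).
Unfolding; no fact; nothing booked. [cite: Miller2011LMS, §1 and Def. 1.1] -/
theorem lowerHalfOnType_of_cmInertBad (hleaf : Summit.BirchSwinnertonDyer.Rank1Residual.X12.CMInertBad)
    (p : ℕ) [Fact p.Prime] (hp5 : 5 ≤ p) : LowerHalfOnType p (.Istar 0) := by
  intro W _ _ hT hr
  have hp2 : p ≠ 2 := by omega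
  have hmiss : X12.MissingInputAt W p := hleaf W p hT.1 hr hp2 hT.2.1 hT.2.2.1
  exact (lower_and_upper_of_missingPPartAt W p (hmiss fun h ↦ hT.2.1.2 h.2)).1

end Summit.BirchSwinnertonDyer.BirchSwinnertonDyer.Theorems.CccOneStubHalves

end
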